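import Summits.MatrixMultiplication.OmegaCensus.STPPVosperSlackTwoRows53B1
import Summits.MatrixMultiplication.OmegaCensus.STPPVosperSlackTwoRows53B2
import Summits.MatrixMultiplication.OmegaCensus.STPPVosperSlackTwoLawABQ

/-!
# ω-census (abelian STPP census): ℤ₅₃ leaf {(2,3,3)³} — case B′ rows assembled (kernel rows → law form)

HONEST FRAMING (pub-omega census; verbatim): lottery ticket; floor = certified bounds/negative ranges.
Census STRUCTURE (seat pub-omega-stpp-2 gen 31, 2026-08-29), family (b2).  The five chunk theorems `rows53B_c0 … rows53B_c4` (`…Rows53B1.lean`, `…Rows53B2.lean`) glued into the hypothesis form the law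
`no_isSTPP_of_slack_two_tables` consumes (`rows53B`, `rows53B_choose`).  No new computation.  Nothing here is progress on `ω`.
-/

namespace Summit.MatrixMultiplication.OmegaCensus.CubeNB.S2

/-- **Assembled case-B′ rows** of the ℤ₅₃ leaf `{(2,3,3)³}`. [folklore] -/
theorem rows53B : ∀ Q ∈ qShapes 53 2 0 52, dihedralSmaller 53 Q = true ∨ caseADeadT 53 3 3 12 18 Q tblZ53B = true := by
  have g0 : ∀ Q ∈ qShapes 53 2 0 39, dihedralSmaller 53 Q = true ∨ caseADeadT 53 3 3 12 18 Q tblZ53B = true := (rowsQ_of_all rows53B_c0)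
  have g1 : ∀ Q ∈ qShapes 53 2 0 46, dihedralSmaller 53 Q = true ∨ caseADeadT 53 3 3 12 18 Q tblZ53B = true :=
    forall_qShapes_append (by decide) (by decide) g0 (rowsQ_of_all rows53B_c1)
  have g2 : ∀ Q ∈ qShapes 53 2 0 49, dihedralSmaller 53 Q = true ∨ caseADeadT 53 3 3 12 18 Q tblZ53B = true :=
    forall_qShapes_append (by decide) (by decide) g1 (rowsQ_of_all rows53B_c2)
  have g3 : ∀ Q ∈ qShapes 53 2 0 50, dihedralSmaller 53 Q = true ∨ caseADeadT 53 3 3 12 18 Q tblZ53B = true :=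
    forall_qShapes_append (by decide) (by decide) g2 (rowsQ_of_all rows53B_c3)
  have g4 : ∀ Q ∈ qShapes 53 2 0 52, dihedralSmaller 53 Q = true ∨ caseADeadT 53 3 3 12 18 Q tblZ53B = true :=
    forall_qShapes_append (by decide) (by decide) g3 (rowsQ_of_all rows53B_c4)
  exact g4

/-- The same with the bound written `(53 − 1).choose (2 − 1)`. [folklore] -/
theorem rows53B_choose : ∀ Q ∈ qShapes 53 2 0 ((53 - 1).choose (2 - 1)), dihedralSmaller 53 Q = true ∨ caseADeadT 53 3 3 12 18 Q tblZ53B = true := by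
  have e : (53 - 1).choose (2 - 1) = 52 := by decide
  rw [e]
  exact rows53B

end Summit.MatrixMultiplication.OmegaCensus.CubeNB.S2
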